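import Literature.NumberTheory.EllipticCurves.CuspFormTwist
import Literature.NumberTheory.EllipticCurves.NewformsMainLemmaSlashRep
import Literature.NumberTheory.EllipticCurves.HeckeOperatorsEigenvalueBoundProofs
import Literature.NumberTheory.Sieve.LargeSieveCharacters
import Literature.NumberTheory.EllipticCurves.NewformsTwistPacketProofs
import Literature.NumberTheory.EllipticCurves.QuadraticTwistNegOneLFunctionProofs
import Literature.NumberTheory.EllipticCurves.CuspFormLFunctionLevelConductorProofs
import Literature.NumberTheory.EllipticCurves.ModularCurveSturmProofs
import Literature.NumberTheory.Automorphic.ShimuraCurveRibetTakahashiPeterssonConvexityCubeProofs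
import HarnessLib

/-!
# The Petersson norm of a quadratic twist, and Mai–Murty's bound `(f, f) ≪ N (log N)³` for curves
# whose twist by `−1` is semistable

Topic `NumberTheory/Automorphic`; namespace `Literature.NumberTheory.Automorphic`. A proofs-only file
(theorems only: no definition, no named fact; D-0026) continuing the work on the
named fact `murty_petersson_newform_upper_bound` of `ShimuraCurveRibetTakahashi.lean`
(`‖f‖² ≪ N log N`, H. Pasten, *Shimura curves and the abc conjecture*, arXiv:1705.09251, §16 p. 49,
from [MaiMurty1994], [MurtyCongruencePrimes1999]). The statement that the cited proof establishes —
Mai–Murty 1994, §2: `(f, f) ≪ N (log N)³` — is proved in the tree for SQUAREFREE levels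
(`exists_petersson_le_mul_log_cube_of_squarefree`, `…ConvexityCubeProofs.lean`). This file makes the
first step beyond squarefree levels, by a device that needs no Fourier expansion at the cusps
`1/(2^j m)` of `Γ₀(2^t M)`: **comparison of Petersson norms across a quadratic twist.**

* `re_peterssonProduct_charTwist_le` — for `g ∈ S_k(Γ₀(N'))`, `N' ∣ L`, `m² ∣ L`, `m ∣ 24` and a
  primitive quadratic Dirichlet character `χ mod m`, the twist
  `g_χ = charTwist L g = g(χ̄)⁻¹ Σ_{u mod m} χ̄(u) g(· + u/m) ∈ S_k(Γ₀(L))` (Shimura 1971, Prop. 3.64;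
  the tree's `CuspFormTwist`) satisfies
  **`Re (g_χ, g_χ)_{Γ₀(L)} ≤ m · [Γ₀(N') : Γ₀(L)] · Re (g, g)_{Γ₀(N')}`**.
  Ingredients, all proved here: for `m ∣ 24` and `m² ∣ L` the translations `[1, u/m; 0, 1]` NORMALISE
  `Γ₀(L)` (`conj_translGL_gamma0_eq`: `ad ≡ 1 (mod m)` forces `a ≡ d` because `(ℤ/m)ˣ` has exponent
  `2`), so each translate `g(· + u/m)` is a cusp form on `Γ₀(L)` (`exists_gamma0Translate`) with the SAME
  Petersson norm as `g` (`peterssonProduct_gamma0Translate`, Diamond–Shurman Prop. 5.5.2(a) =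
  `peterssonProduct_translate_adjoint` with `α = [1, u/m; 0, 1]`); the norm at level `L` is the index
  times the norm at level `N'` (`peterssonProduct_of_le_eq_card_mul`); Cauchy–Schwarz over the `≤ m`
  translates (`norm_peterssonProduct_sum_smul_le`) and `|g(χ̄)|² = m` (`norm_gaussSum_sq`).
* `WeierstrassCurve.LFunction_quadraticTwist_neg_one_apply_of_odd` — `aₙ(E^{(−1)}) = χ₄(n) aₙ(E)` for
  ODD `n`, unconditionally (the tree's all-`n` version needs the additivity of `E^{(−1)}` at `2`).
* `gamma0Index_mul_re_peterssonProduct_le_of_quadraticTwist_neg_one` — for the newform `f` of `E`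
  at a level `N` with `16 ∣ N` and the newform `g` of `E^{(−1)}` at level `N'`:
  **`ψ(N') Re (f,f)_{Γ₀(N)} ≤ 4 ψ(N) Re (g,g)_{Γ₀(N')}`** (`ψ = [SL₂(ℤ) : Γ₀(·)]`): indeed `a_{2n}(f) = 0`
  (`4 ∣ N`, newform theory) and `aₙ(g) = χ₄(n)aₙ(f)` for odd `n`, so `f = g ⊗ χ₄ = charTwist (N N') g`
  coefficientwise (`q`-expansion principle), and the first bullet applies with `m = 4`.
* `re_peterssonProduct_le_of_quadraticTwist_neg_one` — **`Re (f,f) ≤ 96 Re (g,g)`, `N ∣ 16N'`,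
  `N' ∣ 16N`**: the two newforms carry `χ₄`-twisted Hecke packets of each other, so Atkin–Lehner–Li
  level theory (`level_dvd_mul_sq_of_charTwist_packet`) compares the levels, and
  `ψ(N) ≤ ψ(16N') ≤ 24ψ(N')` (`gamma0Index_le_of_dvd`, `gamma0Index_sixteen_mul_le`).
* `exists_petersson_le_mul_log_cube_of_quadraticTwist_neg_one_squarefree` — **Mai–Murty's exponent
  `3` for every `E` with `16 ∣ N` whose twist `E^{(−1)}` has a newform of squarefree level** (e.g.
  `E^{(−1)}` semistable): `Re (f,f) ≤ C · N · (1 + log N)³` with an absolute `C`; and the power form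
  `exists_petersson_le_mul_rpow_of_quadraticTwist_neg_one_squarefree` (`≤ C N^{1+ε}/ε³`, the shape
  consumed by the `abc` routes). Among the Frey–Hellegouarch curves `y² = x(x−a)(x+b)` (coprime
  `a, b > 0`, whose conductors have `v₂(N) ∈ {0, 1, 3, 4, 5}`) this covers those with `2⁴ ∥ N` whose
  sign-swapped model `y² = x(x+a)(x−b) ≅ E^{(−1)}` is semistable.

What is NOT here: levels `2^t M` whose twists are not semistable (`t = 3, 5`, and `t = 4` twisted from
`t = 3`) — these need the Fourier expansions of `f` at the cusps of `Γ₀(2^t M)` not equivalent to `∞`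
under the Atkin–Lehner involutions (work in progress in the same series of files).

## References

* [MaiMurty1994] L. Mai, M. R. Murty, *The Phragmén–Lindelöf theorem and modular elliptic curves*,
  Contemp. Math. 166 (1994), §2 (Proposition: `log (f,f) = O(log N)`, via `L(1, Sym² f) = O((log N)³)`).
* [Shimura1971] G. Shimura, *Introduction to the arithmetic theory of automorphic functions*,
  Prop. 3.64 (twists of modular forms).
* [DiamondShurman2005] F. Diamond, J. Shurman, *A first course in modular forms*, GTM 228,
  Prop. 5.5.2(a), Exercise 5.4.4, Prop. 5.8.5.
* [AtkinLi1978] A. O. L. Atkin, W.-C. W. Li, *Twists of newforms and pseudo-eigenvalues of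
  `W`-operators*, Invent. Math. 48 (1978), §3.
* [SilvermanAEC2009] J. H. Silverman, *The arithmetic of elliptic curves*, X.5 Cor. 5.4, Exercise 10.16.
* [PastenShimura2024] H. Pasten, *Shimura curves and the abc conjecture*, J. Number Theory 254 (2024)
  = arXiv:1705.09251, §16 p. 49.
-/

noncomputable section

open scoped MatrixGroups ModularForm Pointwise ComplexConjugate
open Matrix.SpecialLinearGroup Matrix.GeneralLinearGroup UpperHalfPlane Complex ConjAct
open Literature.NumberTheory.EllipticCurves.ModularForms CongruenceSubgroup

namespace Literature.NumberTheory.Automorphic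

/-! ### `Γ₀(L)` is normalised by the translations `τ ↦ τ + u/m` when `m² ∣ L` and `m ∣ 24` -/

section Normaliser

/-- For `m ∣ 24` the unit group of `ℤ/mℤ` has exponent `2`: `x y = 1 ⇒ x = y` in `ZMod m`.
[folklore] -/
theorem ZMod.eq_of_mul_eq_one_of_dvd_twentyFour {m : ℕ} (hm : m ∣ 24) {x y : ZMod m}
    (h : x * y = 1) : x = y := by
  have hm' : m ∈ Nat.divisors 24 := Nat.mem_divisors.mpr ⟨hm, by norm_num⟩
  have hdiv : Nat.divisors 24 = {1, 2, 3, 4, 6, 8, 12, 24} := by decide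
  rw [hdiv] at hm'
  simp only [Finset.mem_insert, Finset.mem_singleton] at hm'
  rcases hm' with rfl | rfl | rfl | rfl | rfl | rfl | rfl | rfl <;> revert x y <;> decide

/-- For `γ = (a b; c d) ∈ SL₂(ℤ)` with `m ∣ c` and `m ∣ 24`: `a ≡ d (mod m)` (`ad ≡ 1`, and the
units mod `m` square to `1`). [folklore] -/
theorem dvd_sub_entries_of_dvd_twentyFour {m : ℕ} (hm : m ∣ 24) (γ : SL(2, ℤ))
    (h : (m : ℤ) ∣ γ 1 0) : (m : ℤ) ∣ γ 1 1 - γ 0 0 := by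
  rw [← ZMod.intCast_zmod_eq_zero_iff_dvd, Int.cast_sub, sub_eq_zero]
  exact (ZMod.eq_of_mul_eq_one_of_dvd_twentyFour hm (natCast_mul_natCast_eq_one_of_dvd γ h)).symm

/-- **Conjugating `SL₂(ℤ)` by the translation `[1, u/m; 0, 1]`**: for `γ = (a b; c d)` with `m² ∣ c`
and `m ∣ d − a`, the conjugate `[1, u/m; 0, 1] γ [1, −u/m; 0, 1]` is again an integral matrix of
determinant `1` with the same lower-left entry `c` — explicitly, with `c = m² c₂`, `d − a = m t`,
`γ'' = (a + u m c₂, b + u t − u² c₂; c, d − u m c₂)`. [folklore] -/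
theorem exists_translGL_mul_mul_translGL_neg_eq {m : ℕ} [NeZero m] (γ : SL(2, ℤ))
    (hc : ((m : ℤ) ^ 2) ∣ γ 1 0) (hda : (m : ℤ) ∣ γ 1 1 - γ 0 0) (u : ℤ) :
    ∃ γ'' : SL(2, ℤ), γ'' 1 0 = γ 1 0 ∧
      glCast (translGL ((u : ℚ) / m) : GL (Fin 2) ℚ) * (mapGL ℝ γ : GL (Fin 2) ℝ) *
          glCast (translGL (-((u : ℚ) / m)) : GL (Fin 2) ℚ) =
        (mapGL ℝ γ'' : GL (Fin 2) ℝ) := by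
  obtain ⟨c₂, hc₂⟩ := hc
  obtain ⟨t, ht⟩ := hda
  set a := γ 0 0 with ha
  set b := γ 0 1 with hb
  set c := γ 1 0 with hc
  set d := γ 1 1 with hd
  have hm0 : (m : ℝ) ≠ 0 := by exact_mod_cast NeZero.ne m
  have hdet : a * d - b * (m ^ 2 * c₂) = 1 := by
    have := det_entries γ
    rw [← hc₂]
    linear_combination this
  let A : Matrix (Fin 2) (Fin 2) ℤ :=
    !![a + u * m * c₂, b + u * t - u ^ 2 * c₂; m ^ 2 * c₂, d - u * m * c₂]
  have hA : A.det = 1 := by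
    rw [Matrix.det_fin_two_of]
    linear_combination hdet + u * m * c₂ * ht
  refine ⟨⟨A, hA⟩, ?_, ?_⟩
  · change A 1 0 = c
    simp [A, hc₂]
  · refine Units.ext ?_
    have hγ : ((mapGL ℝ γ : GL (Fin 2) ℝ) : Matrix (Fin 2) (Fin 2) ℝ) =
        !![(a : ℝ), (b : ℝ); (m : ℝ) ^ 2 * c₂, (d : ℝ)] := by
      rw [val_mapGL']
      ext i j
      fin_cases i <;> fin_cases j <;> simp [← ha, ← hb, ← hc, ← hd, hc₂]
    have hγ'' : ((mapGL ℝ (⟨A, hA⟩ : SL(2, ℤ)) : GL (Fin 2) ℝ) : Matrix (Fin 2) (Fin 2) ℝ) =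
        !![(a : ℝ) + u * m * c₂, (b : ℝ) + u * t - u ^ 2 * c₂;
          (m : ℝ) ^ 2 * c₂, (d : ℝ) - u * m * c₂] := by
      rw [val_mapGL']
      ext i j
      fin_cases i <;> fin_cases j <;> simp [A]
    have htr : (d : ℝ) - a = m * t := by exact_mod_cast ht
    rw [Matrix.GeneralLinearGroup.coe_mul, Matrix.GeneralLinearGroup.coe_mul, coe_glCast_translGL,
      coe_glCast_translGL, hγ, hγ'']
    push_cast
    ext i j
    fin_cases i <;> fin_cases j
    · simp [Matrix.mul_apply, Fin.sum_univ_two]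
      field_simp
    · simp [Matrix.mul_apply, Fin.sum_univ_two]
      field_simp
      linear_combination (u : ℝ) * htr
    · simp [Matrix.mul_apply, Fin.sum_univ_two]
    · simp [Matrix.mul_apply, Fin.sum_univ_two]
      field_simp
      ring

/-- `[1, −r; 0, 1] = [1, r; 0, 1]⁻¹` in `GL(2, ℝ)`. [folklore] -/
theorem glCast_translGL_neg (r : ℚ) :
    glCast (translGL (-r) : GL (Fin 2) ℚ) = (glCast (translGL r : GL (Fin 2) ℚ))⁻¹ := by
  rw [eq_inv_iff_mul_eq_one]
  refine Units.ext ?_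
  rw [Matrix.GeneralLinearGroup.coe_mul, coe_glCast_translGL, coe_glCast_translGL]
  ext i j
  fin_cases i <;> fin_cases j <;> simp [Matrix.mul_apply, Fin.sum_univ_two]

/-- The matrix of `[1, −r; 0, 1]` is the adjugate of that of `[1, r; 0, 1]` (both have determinant
`1`), the shape required by `peterssonProduct_translate_adjoint`. [folklore] -/
theorem coe_translGL_neg_eq_adjugate (r : ℚ) :
    ((translGL (-r) : GL (Fin 2) ℚ) : Matrix (Fin 2) (Fin 2) ℚ) =
      ((translGL r : GL (Fin 2) ℚ) : Matrix (Fin 2) (Fin 2) ℚ).adjugate := by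
  have h1 : ((translGL (-r) : GL (Fin 2) ℚ) : Matrix (Fin 2) (Fin 2) ℚ) = !![1, -r; 0, 1] := rfl
  have h2 : ((translGL r : GL (Fin 2) ℚ) : Matrix (Fin 2) (Fin 2) ℚ) = !![1, r; 0, 1] := rfl
  rw [h1, h2, Matrix.adjugate_fin_two_of]
  simp

variable {L m : ℕ}

/-- **`[1, u/m; 0, 1]` conjugates `Γ₀(L)` into itself** when `m² ∣ L` and `m ∣ 24`: for
`γ ∈ Γ₀(L)`, `[1, u/m; 0, 1] γ [1, u/m; 0, 1]⁻¹ ∈ Γ₀(L)` (inside `GL(2, ℝ)`). [folklore] -/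
theorem translGL_mul_mul_inv_mem_gamma0 [NeZero m] (hm : m ^ 2 ∣ L) (h24 : m ∣ 24) (u : ℤ)
    {x : GL (Fin 2) ℝ} (hx : x ∈ ((Gamma0 L : Subgroup SL(2, ℤ)) : Subgroup (GL (Fin 2) ℝ))) :
    glCast (translGL ((u : ℚ) / m) : GL (Fin 2) ℚ) * x *
        (glCast (translGL ((u : ℚ) / m) : GL (Fin 2) ℚ))⁻¹ ∈
      ((Gamma0 L : Subgroup SL(2, ℤ)) : Subgroup (GL (Fin 2) ℝ)) := by
  obtain ⟨γ, hγ, rfl⟩ := hx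
  have hc : ((m : ℤ) ^ 2) ∣ γ 1 0 := sq_dvd_entry_of_mem_Gamma0 hm hγ
  have hmc : (m : ℤ) ∣ γ 1 0 := (dvd_pow_self (m : ℤ) two_ne_zero).trans hc
  obtain ⟨γ'', hγ''c, h⟩ := exists_translGL_mul_mul_translGL_neg_eq γ hc
    (dvd_sub_entries_of_dvd_twentyFour h24 γ hmc) u
  rw [← glCast_translGL_neg, h]
  exact ⟨γ'', mem_Gamma0_of_entry_eq dvd_rfl hγ hγ''c, rfl⟩

/-- **The translation `[1, u/m; 0, 1]` normalises `Γ₀(L)`** (`m² ∣ L`, `m ∣ 24`):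
`[1, u/m; 0, 1]⁻¹ Γ₀(L) [1, u/m; 0, 1] = Γ₀(L)` as subgroups of `GL(2, ℝ)`. [folklore] -/
theorem conj_translGL_gamma0_eq [NeZero m] (hm : m ^ 2 ∣ L) (h24 : m ∣ 24) (u : ℤ) :
    toConjAct (glCast (translGL ((u : ℚ) / m) : GL (Fin 2) ℚ))⁻¹ •
        ((Gamma0 L : Subgroup SL(2, ℤ)) : Subgroup (GL (Fin 2) ℝ)) =
      ((Gamma0 L : Subgroup SL(2, ℤ)) : Subgroup (GL (Fin 2) ℝ)) := by
  set T : GL (Fin 2) ℝ := glCast (translGL ((u : ℚ) / m) : GL (Fin 2) ℚ) with hT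
  have hTneg : glCast (translGL (((-u : ℤ) : ℚ) / m) : GL (Fin 2) ℚ) = T⁻¹ := by
    rw [hT, ← glCast_translGL_neg]
    congr 2
    push_cast
    ring
  ext x
  rw [Subgroup.mem_pointwise_smul_iff_inv_smul_mem, toConjAct_inv, inv_inv, toConjAct_smul]
  constructor
  · intro h
    -- `x = T⁻¹ (T x T⁻¹) T`, a conjugate by `[1, -u/m; 0, 1]` of an element of `Γ₀(L)`
    have h' := translGL_mul_mul_inv_mem_gamma0 hm h24 (-u) h
    rwa [hTneg, inv_inv, ← mul_assoc, ← mul_assoc, inv_mul_cancel, one_mul, mul_assoc,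
      inv_mul_cancel, mul_one] at h'
  · exact translGL_mul_mul_inv_mem_gamma0 hm h24 u

end Normaliser

/-! ### The translate `g(τ + u/m)` as a cusp form on `Γ₀(L)` and its Petersson norm -/

section Translate

variable (L : ℕ) [NeZero L] {m : ℕ} [NeZero m] {k : ℤ}

/-- **The translate `g(τ + u/m)` of `g ∈ S_k(Γ₀(L))` is again a cusp form on `Γ₀(L)`** when
`m² ∣ L` and `m ∣ 24` (the translation normalises `Γ₀(L)`, `conj_translGL_gamma0_eq`): there is a
cusp form on `Γ₀(L)` whose underlying function is `g ∣[k] [1, u/m; 0, 1]`. [folklore] -/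
theorem exists_gamma0Translate (hm : m ^ 2 ∣ L) (h24 : m ∣ 24) (g : CuspForm (Gamma0 L) k) (u : ℤ) :
    ∃ G : CuspForm (Gamma0 L) k,
      (⇑G : ℍ → ℂ) = (⇑g : ℍ → ℂ) ∣[k] glCast (translGL ((u : ℚ) / m) : GL (Fin 2) ℚ) := by
  refine ⟨cuspFormOfInvariant (CuspForm.translate g (glCast (translGL ((u : ℚ) / m) : GL (Fin 2) ℚ)))
    fun γ hγ ↦ ?_, rfl⟩
  rw [coe_cuspForm_translate]
  have hmem : glCast (translGL ((u : ℚ) / m) : GL (Fin 2) ℚ) * γ *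
      (glCast (translGL ((u : ℚ) / m) : GL (Fin 2) ℚ))⁻¹ ∈
      ((Gamma0 L : Subgroup SL(2, ℤ)) : Subgroup (GL (Fin 2) ℝ)) :=
    translGL_mul_mul_inv_mem_gamma0 hm h24 u hγ
  have h := SlashInvariantFormClass.slash_action_eq g _ hmem
  calc ((⇑g : ℍ → ℂ) ∣[k] glCast (translGL ((u : ℚ) / m) : GL (Fin 2) ℚ)) ∣[k] γ
      = ((⇑g : ℍ → ℂ) ∣[k] (glCast (translGL ((u : ℚ) / m) : GL (Fin 2) ℚ) * γ *
          (glCast (translGL ((u : ℚ) / m) : GL (Fin 2) ℚ))⁻¹)) ∣[k]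
          glCast (translGL ((u : ℚ) / m) : GL (Fin 2) ℚ) := by
        rw [← SlashAction.slash_mul, ← SlashAction.slash_mul, inv_mul_cancel_right]
    _ = (⇑g : ℍ → ℂ) ∣[k] glCast (translGL ((u : ℚ) / m) : GL (Fin 2) ℚ) := by rw [h]

/-- **The Petersson norm is translation invariant**: if `G ∈ S_k(Γ₀(L))` has underlying function
`g ∣[k] [1, u/m; 0, 1]` (`m² ∣ L`, `m ∣ 24`), then `P_{Γ₀(L)}(G, G) = P_{Γ₀(L)}(g, g)` —
Diamond–Shurman Prop. 5.5.2(a) (`peterssonProduct_translate_adjoint`) with `α = [1, u/m; 0, 1]`,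
`α' = α⁻¹` and `α⁻¹Γ₀(L)α = Γ₀(L)`. [cite: DiamondShurman2005, Prop. 5.5.2(a)] -/
theorem peterssonProduct_gamma0Translate (hm : m ^ 2 ∣ L) (h24 : m ∣ 24) (g : CuspForm (Gamma0 L) k)
    (u : ℤ) (G : CuspForm (Gamma0 L) k)
    (hG : (⇑G : ℍ → ℂ) = (⇑g : ℍ → ℂ) ∣[k] glCast (translGL ((u : ℚ) / m) : GL (Fin 2) ℚ)) :
    peterssonProduct (Gamma0 L) k G G = peterssonProduct (Gamma0 L) k g g := by
  have hSL : ((Gamma0 L : Subgroup SL(2, ℤ)) : Subgroup (GL (Fin 2) ℝ)) ≤ 𝒮ℒ :=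
    Subgroup.map_le_range _ _
  refine peterssonProduct_translate_adjoint ((Gamma0 L : Subgroup SL(2, ℤ)) : Subgroup (GL (Fin 2) ℝ))
    hSL k (translGL ((u : ℚ) / m)) (translGL (-((u : ℚ) / m))) (coe_translGL_neg_eq_adjugate _)
    ((Gamma0 L : Subgroup SL(2, ℤ)) : Subgroup (GL (Fin 2) ℝ)) (conj_translGL_gamma0_eq hm h24 u).symm
    hSL g G G g hG ?_
  rw [hG, ← SlashAction.slash_mul, glCast_translGL_neg, mul_inv_cancel, SlashAction.slash_one]

end Translate

/-! ### Cauchy–Schwarz for finite sums in the Petersson product -/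

section SumBound

variable (Γ : Subgroup (GL (Fin 2) ℝ)) [Γ.IsArithmetic] [Γ.HasDetOne] (k : ℤ)

/-- Additivity of the Petersson product over finite sums in the first variable. [folklore] -/
theorem peterssonProduct_sum_left {ι : Type*} (s : Finset ι) (F : ι → CuspForm Γ k)
    (g : CuspForm Γ k) :
    peterssonProduct Γ k (∑ i ∈ s, F i) g = ∑ i ∈ s, peterssonProduct Γ k (F i) g := by
  induction s using Finset.cons_induction with
  | empty => simp [peterssonProduct_zero_left Γ k]
  | cons a s ha ih => rw [Finset.sum_cons, Finset.sum_cons, peterssonProduct_add_left, ih]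

/-- Additivity of the Petersson product over finite sums in the second variable. [folklore] -/
theorem peterssonProduct_sum_right {ι : Type*} (s : Finset ι) (f : CuspForm Γ k)
    (G : ι → CuspForm Γ k) :
    peterssonProduct Γ k f (∑ i ∈ s, G i) = ∑ i ∈ s, peterssonProduct Γ k f (G i) := by
  induction s using Finset.cons_induction with
  | empty => simp [peterssonProduct_zero_right k]
  | cons a s ha ih => rw [Finset.sum_cons, Finset.sum_cons, peterssonProduct_add_right, ih]

/-- Cauchy–Schwarz with square roots: `‖P(f, g)‖ ≤ √(Re P(f, f)) · √(Re P(g, g))`. [folklore] -/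
theorem norm_peterssonProduct_le_sqrt_mul_sqrt (f g : CuspForm Γ k) :
    ‖peterssonProduct Γ k f g‖ ≤
      Real.sqrt (peterssonProduct Γ k f f).re * Real.sqrt (peterssonProduct Γ k g g).re := by
  have h := Real.sqrt_le_sqrt (norm_sq_peterssonProduct_le Γ k f g)
  rwa [Real.sqrt_sq (norm_nonneg _),
    Real.sqrt_mul (re_peterssonProduct_self_nonneg_level Γ k f)] at h

/-- **The Petersson norm of a finite linear combination**: if `Re P(Fᵢ, Fᵢ) ≤ X` for all `i ∈ s`,
then `‖P(Σ cᵢ Fᵢ, Σ cᵢ Fᵢ)‖ ≤ (Σ ‖cᵢ‖)² X` (expand bilinearly and apply Cauchy–Schwarz to each of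
the `|s|²` terms). [folklore] -/
theorem norm_peterssonProduct_sum_smul_le {ι : Type*} (s : Finset ι) (c : ι → ℂ)
    (F : ι → CuspForm Γ k) {X : ℝ} (hX : ∀ i ∈ s, (peterssonProduct Γ k (F i) (F i)).re ≤ X) :
    ‖peterssonProduct Γ k (∑ i ∈ s, c i • F i) (∑ i ∈ s, c i • F i)‖ ≤
      (∑ i ∈ s, ‖c i‖) ^ 2 * X := by
  rw [peterssonProduct_sum_left Γ k]
  simp_rw [peterssonProduct_sum_right Γ k, peterssonProduct_smul_left, peterssonProduct_smul_right]
  calc ‖∑ i ∈ s, ∑ j ∈ s, conj (c i) * (c j * peterssonProduct Γ k (F i) (F j))‖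
      ≤ ∑ i ∈ s, ‖∑ j ∈ s, conj (c i) * (c j * peterssonProduct Γ k (F i) (F j))‖ :=
        norm_sum_le _ _
    _ ≤ ∑ i ∈ s, ∑ j ∈ s, ‖c i‖ * ‖c j‖ * X := by
        refine Finset.sum_le_sum fun i hi ↦ (norm_sum_le _ _).trans (Finset.sum_le_sum fun j hj ↦ ?_)
        rw [norm_mul, norm_mul, Complex.norm_conj, mul_assoc]
        refine mul_le_mul_of_nonneg_left (mul_le_mul_of_nonneg_left ?_ (norm_nonneg _))
          (norm_nonneg _)
        have hi0 := re_peterssonProduct_self_nonneg_level Γ k (F i)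
        have hj0 := re_peterssonProduct_self_nonneg_level Γ k (F j)
        have hX0 : 0 ≤ X := hi0.trans (hX i hi)
        calc ‖peterssonProduct Γ k (F i) (F j)‖
            ≤ Real.sqrt (peterssonProduct Γ k (F i) (F i)).re *
                Real.sqrt (peterssonProduct Γ k (F j) (F j)).re :=
              norm_peterssonProduct_le_sqrt_mul_sqrt Γ k (F i) (F j)
          _ ≤ Real.sqrt X * Real.sqrt X :=
              mul_le_mul (Real.sqrt_le_sqrt (hX i hi)) (Real.sqrt_le_sqrt (hX j hj))
                (Real.sqrt_nonneg _) (Real.sqrt_nonneg _)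
          _ = X := Real.mul_self_sqrt hX0
    _ = (∑ i ∈ s, ‖c i‖) ^ 2 * X := by
        rw [sq, Finset.sum_mul_sum, Finset.sum_mul]
        refine Finset.sum_congr rfl fun i _ ↦ ?_
        rw [Finset.sum_mul]

end SumBound

/-! ### The comparison `‖g ⊗ χ‖² ≤ m · [Γ₀(N') : Γ₀(L)] · ‖g‖²` -/

section Comparison

variable {N' L m : ℕ} [NeZero N'] [NeZero L] [NeZero m] {k : ℤ}

omit [NeZero N'] [NeZero L] in
/-- `Γ₀(L) ≤ Γ₀(N')` inside `GL(2, ℝ)` for `N' ∣ L`. [folklore] -/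
theorem gamma0_map_le_of_dvd (hN : N' ∣ L) :
    ((Gamma0 L : Subgroup SL(2, ℤ)) : Subgroup (GL (Fin 2) ℝ)) ≤
      ((Gamma0 N' : Subgroup SL(2, ℤ)) : Subgroup (GL (Fin 2) ℝ)) := by
  refine Subgroup.map_mono fun γ hγ ↦ ?_
  rw [Gamma0_mem, ZMod.intCast_zmod_eq_zero_iff_dvd] at hγ ⊢
  exact (Int.natCast_dvd_natCast.mpr hN).trans hγ

omit [NeZero m] in
/-- `[1, u/m; 0, 1] = twistT u` in `GL(2, ℝ)` for `u mod m` (represented by `u.val`). [folklore] -/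
theorem glCast_translGL_eq_twistT (u : ZMod m) :
    glCast (translGL (((u.val : ℤ) : ℚ) / m) : GL (Fin 2) ℚ) = twistT u := by
  refine Units.ext ?_
  rw [coe_glCast_translGL, val_twistT]
  push_cast
  rfl

/-- **The Petersson norm of a quadratic twist is controlled by that of the form**: for
`g ∈ S_k(Γ₀(N'))`, `N' ∣ L`, `m² ∣ L`, `m ∣ 24` and a primitive quadratic character `χ mod m`,
`Re P_{Γ₀(L)}(g_χ, g_χ) ≤ m · [Γ₀(N') : Γ₀(L)] · Re P_{Γ₀(N')}(g, g)` for the twist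
`g_χ = charTwist L g = g(χ)⁻¹ Σ_u χ⁻¹(u) g(· + u/m) ∈ S_k(Γ₀(L))` (Shimura 1971, Prop. 3.64): each
translate has the Petersson norm of `g` at level `L` (`peterssonProduct_gamma0Translate`, the
translations normalise `Γ₀(L)`), which is `[Γ₀(N') : Γ₀(L)]` times the norm at level `N'`
(`peterssonProduct_of_le_eq_card_mul`); Cauchy–Schwarz over the `≤ m` translates and
`|g(χ)|² = m`. [cite: Shimura1971, Prop. 3.64] [cite: DiamondShurman2005, Prop. 5.5.2(a) and Exercise 5.4.4] -/
theorem re_peterssonProduct_charTwist_le (hN : N' ∣ L) (hm : m ^ 2 ∣ L) (h24 : m ∣ 24)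
    {χ : DirichletCharacter ℂ m} (hχ : χ.IsQuadratic) (hprim : χ.IsPrimitive)
    (g : CuspForm (Gamma0 N') k) :
    (peterssonProduct (Gamma0 L) k (charTwist L hN hm hχ g) (charTwist L hN hm hχ g)).re ≤
      m * Nat.card (((Gamma0 N' : Subgroup SL(2, ℤ)) : Subgroup (GL (Fin 2) ℝ)) ⧸
          (((Gamma0 L : Subgroup SL(2, ℤ)) : Subgroup (GL (Fin 2) ℝ))).subgroupOf
            ((Gamma0 N' : Subgroup SL(2, ℤ)) : Subgroup (GL (Fin 2) ℝ))) *
        (peterssonProduct (Gamma0 N') k g g).re := by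
  -- `g` at level `L` and its translates
  obtain ⟨gL, hgL⟩ := exists_cuspForm_coe_eq_of_le (gamma0_map_le_of_dvd hN) g
  choose G hG using fun u : ZMod m ↦ exists_gamma0Translate L hm h24 gL (u.val : ℤ)
  set τχ : ℂ := gaussSum χ⁻¹ (ZMod.stdAddChar (N := m)) with hτχ
  -- the twist is `g(χ⁻¹)⁻¹ • Σ_u χ⁻¹(u) • G u`
  have hsum : charTwist L hN hm hχ g = τχ⁻¹ • ∑ u : ZMod m, χ⁻¹ u • G u := by
    apply DFunLike.ext'
    rw [coe_charTwist, coe_twistRaw, CuspForm.IsGLPos.coe_smul]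
    congr 1
    have h := map_sum (CuspForm.coeHom (Γ := ((Gamma0 L : Subgroup SL(2, ℤ)) :
      Subgroup (GL (Fin 2) ℝ))) (k := k)) (fun u : ZMod m ↦ χ⁻¹ u • G u) Finset.univ
    refine (Finset.sum_congr rfl fun u _ ↦ ?_).trans h.symm
    change χ⁻¹ u • ((⇑g : ℍ → ℂ) ∣[k] twistT u) = ⇑(χ⁻¹ u • G u)
    rw [CuspForm.IsGLPos.coe_smul, hG, glCast_translGL_eq_twistT, hgL]
  -- every translate has the norm of `g` at level `L`
  set X : ℝ := (peterssonProduct (Gamma0 L) k gL gL).re with hX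
  have hGX : ∀ u ∈ (Finset.univ : Finset (ZMod m)), (peterssonProduct (Gamma0 L) k (G u) (G u)).re ≤ X :=
    fun u _ ↦ by rw [peterssonProduct_gamma0Translate L hm h24 gL _ (G u) (hG u)]
  have hXeq : X = Nat.card (((Gamma0 N' : Subgroup SL(2, ℤ)) : Subgroup (GL (Fin 2) ℝ)) ⧸
      (((Gamma0 L : Subgroup SL(2, ℤ)) : Subgroup (GL (Fin 2) ℝ))).subgroupOf
        ((Gamma0 N' : Subgroup SL(2, ℤ)) : Subgroup (GL (Fin 2) ℝ))) *
        (peterssonProduct (Gamma0 N') k g g).re := by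
    rw [hX, peterssonProduct_of_le_eq_card_mul k (gamma0_map_le_of_dvd hN) (Subgroup.map_le_range _ _)
      gL gL g g hgL hgL]
    simp only [Complex.mul_re, Complex.natCast_re, Complex.natCast_im, zero_mul, sub_zero]
  -- Cauchy–Schwarz over the translates
  have hCS := norm_peterssonProduct_sum_smul_le ((Gamma0 L : Subgroup SL(2, ℤ)) :
    Subgroup (GL (Fin 2) ℝ)) k Finset.univ (fun u ↦ χ⁻¹ u) G hGX
  have hcoef : ∑ u : ZMod m, ‖χ⁻¹ u‖ ≤ m := by
    calc ∑ u : ZMod m, ‖χ⁻¹ u‖ ≤ ∑ _u : ZMod m, (1 : ℝ) :=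
          Finset.sum_le_sum fun u _ ↦ DirichletCharacter.norm_le_one χ⁻¹ u
      _ = m := by rw [Finset.sum_const, Finset.card_univ, ZMod.card, nsmul_eq_mul, mul_one]
  have hX0 : 0 ≤ X := re_peterssonProduct_self_nonneg_level _ k gL
  have hτ : ‖τχ‖ ^ 2 = m := Sieve.LargeSieve.norm_gaussSum_sq (isPrimitive_inv hprim)
  rw [hsum, peterssonProduct_smul_smul, ← Complex.normSq_eq_conj_mul_self, Complex.re_ofReal_mul,
    map_inv₀, Complex.normSq_eq_norm_sq, hτ]
  conv_rhs => rw [mul_assoc, ← hXeq]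
  have hm0 : (0 : ℝ) < m := Nat.cast_pos.mpr (NeZero.pos m)
  calc ((m : ℝ))⁻¹ * (peterssonProduct (Gamma0 L) k (∑ u, χ⁻¹ u • G u) (∑ u, χ⁻¹ u • G u)).re
      ≤ ((m : ℝ))⁻¹ * ((∑ u : ZMod m, ‖χ⁻¹ u‖) ^ 2 * X) :=
        mul_le_mul_of_nonneg_left ((Complex.re_le_norm _).trans hCS) (inv_nonneg.mpr hm0.le)
    _ ≤ ((m : ℝ))⁻¹ * ((m : ℝ) ^ 2 * X) := by gcongr
    _ = m * X := by field_simp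

end Comparison

end Literature.NumberTheory.Automorphic

/-! ### `aₙ(E^{(−1)}) = χ₄(n) aₙ(E)` for odd `n`, unconditionally -/

namespace WeierstrassCurve

open IsDedekindDomain IsDedekindDomain.HeightOneSpectrum NumberField Rat.HeightOneSpectrum IsLocalRing
  Literature.NumberTheory.EllipticCurves.ModularForms

/-- **`aₙ(E^{(−1)}) = χ₄(n) aₙ(E)` for every ODD `n`** and every elliptic curve `E/ℚ` (any model
`W`), with no hypothesis at the place `2`: the local factors of `E^{(−1)}` at the odd places are
those of `E` rescaled by `χ₄` (`localEulerFactor_quadraticTwist_neg_one_of_odd`), and an odd `n` has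
no contribution from the place over `2` (the tree's `LFunction_quadraticTwist_neg_one_apply` covers all
`n` but needs the additivity of the twist at `2`). Silverman, *AEC* X.5 Cor. 5.4, Exercise 10.16.
[cite: SilvermanAEC2009, X.5 Cor. 5.4 and Exercise 10.16] -/
theorem LFunction_quadraticTwist_neg_one_apply_of_odd (W : WeierstrassCurve ℚ) [W.IsElliptic]
    {n : ℕ} (hn : ¬ 2 ∣ n) : (W.quadraticTwist (-1)).LFunction n = ZMod.χ₄ n * W.LFunction n := by
  haveI : (W.quadraticTwist (-1 : ℚ)).IsElliptic := W.isElliptic_quadraticTwist (by norm_num)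
  rw [LFunction_eq_eulerProduct, LFunction_eq_eulerProduct]
  refine ArithmeticFunction.eulerProduct_apply_eq_mul_of_forall (P := fun n ↦ ¬ 2 ∣ n)
    (fun m n h ↦ ⟨fun hm ↦ h (dvd_mul_of_dvd_left hm n), fun hn' ↦ h (dvd_mul_of_dvd_right hn' m)⟩)
    (fun n : ℕ ↦ (ZMod.χ₄ n : ℤ)) (by simp) (fun m n ↦ by rw [Nat.cast_mul, map_mul]) _ _
    (fun v m hm ↦ ?_) (eventually_cofinite_localEulerFactor_apply _)
    (eventually_cofinite_localEulerFactor_apply _) hn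
  haveI := Fact.mk (primesEquiv v).2
  have hℓ1 : 1 < (primesEquiv v : ℕ) := (primesEquiv v).2.one_lt
  by_cases hv2 : (primesEquiv v : ℕ) = 2
  · -- the place over `2`: an odd `m` supported on powers of `2` is `m = 1`
    by_cases hm1 : m = 1
    · subst hm1
      rw [localEulerFactor_apply_one, localEulerFactor_apply_one, Nat.cast_one, map_one, one_mul]
    · have hpow : ¬ ∃ k, Nat.card (ResidueField (v.adicCompletionIntegers ℚ)) ^ k = m := by
        rw [natCard_residueField_adicCompletionIntegers, hv2]
        rintro ⟨k, rfl⟩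
        rcases k with _ | k
        · exact hm1 (pow_zero 2)
        · exact hm (dvd_pow_self 2 k.succ_ne_zero)
      rw [localEulerFactor_apply_eq_zero _ _ (by rwa [natCard_residueField_adicCompletionIntegers]) hpow,
        localEulerFactor_apply_eq_zero _ _ (by rwa [natCard_residueField_adicCompletionIntegers]) hpow,
        mul_zero]
  · -- an odd place
    rw [W.localEulerFactor_quadraticTwist_neg_one_of_odd v hv2, localEulerFactor,
      natCard_residueField_adicCompletionIntegers]
    exact ArithmeticFunction.ofPowerSeries_rescale_apply hℓ1 (fun n : ℕ ↦ (ZMod.χ₄ n : ℤ))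
      (by simp) (fun m n ↦ by rw [Nat.cast_mul, map_mul]) _ m

end WeierstrassCurve

namespace Literature.NumberTheory.Automorphic

/-! ### The index `[SL₂(ℤ) : Γ₀(N)]` along `Γ₀(N) ≥ Γ₀(L)` and two elementary bounds -/

section Index

/-- **`[Γ₀(N) : Γ₀(L)] · [SL₂(ℤ) : Γ₀(N)] = [SL₂(ℤ) : Γ₀(L)]`** for `N ∣ L`, with the indices
`gamma0Index` of the tree (`index_gamma0_eq_gamma0Index_holds`) and the relative index computed in
`GL(2, ℝ)` (where the Petersson products live; `SL₂(ℤ) → GL(2, ℝ)` is injective). [folklore] -/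
theorem card_quotient_mul_gamma0Index {N L : ℕ} [NeZero N] [NeZero L] (h : N ∣ L) :
    Nat.card (((Gamma0 N : Subgroup SL(2, ℤ)) : Subgroup (GL (Fin 2) ℝ)) ⧸
        (((Gamma0 L : Subgroup SL(2, ℤ)) : Subgroup (GL (Fin 2) ℝ))).subgroupOf
          ((Gamma0 N : Subgroup SL(2, ℤ)) : Subgroup (GL (Fin 2) ℝ))) * gamma0Index N =
      gamma0Index L := by
  have hle : Gamma0 L ≤ Gamma0 N := fun γ hγ ↦ by
    rw [Gamma0_mem, ZMod.intCast_zmod_eq_zero_iff_dvd] at hγ ⊢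
    exact (Int.natCast_dvd_natCast.mpr h).trans hγ
  have h1 : Nat.card (((Gamma0 N : Subgroup SL(2, ℤ)) : Subgroup (GL (Fin 2) ℝ)) ⧸
      (((Gamma0 L : Subgroup SL(2, ℤ)) : Subgroup (GL (Fin 2) ℝ))).subgroupOf
        ((Gamma0 N : Subgroup SL(2, ℤ)) : Subgroup (GL (Fin 2) ℝ))) =
      (Gamma0 L).relIndex (Gamma0 N) :=
    Subgroup.relIndex_map_map_of_injective _ _ (Matrix.SpecialLinearGroup.mapGL_injective)
  rw [h1, ← index_gamma0_eq_gamma0Index_holds N, ← index_gamma0_eq_gamma0Index_holds L]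
  exact Subgroup.relIndex_mul_index hle

/-- **Monotonicity of `ψ(N) = [SL₂(ℤ) : Γ₀(N)]` under divisibility**: `a ∣ b ≠ 0 ⇒ ψ(a) ≤ ψ(b)`
(termwise on `ψ(N) = ∏_{p^e ∥ N} p^{e−1}(p+1)`). [folklore] -/
theorem gamma0Index_le_of_dvd {a b : ℕ} (h : a ∣ b) (hb : b ≠ 0) : gamma0Index a ≤ gamma0Index b := by
  have ha : a ≠ 0 := fun h0 ↦ hb (zero_dvd_iff.mp (h0 ▸ h))
  have hfac : a.factorization ≤ b.factorization := (Nat.factorization_le_iff_dvd ha hb).mpr h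
  unfold gamma0Index
  rw [Finsupp.prod, Finsupp.prod, Nat.support_factorization, Nat.support_factorization]
  calc ∏ p ∈ a.primeFactors, p ^ (a.factorization p - 1) * (p + 1)
      ≤ ∏ p ∈ a.primeFactors, p ^ (b.factorization p - 1) * (p + 1) := by
        refine Finset.prod_le_prod (fun p _ ↦ Nat.zero_le _) fun p hp ↦ ?_
        exact Nat.mul_le_mul_right _ (Nat.pow_le_pow_right (Nat.prime_of_mem_primeFactors hp).pos
          (Nat.sub_le_sub_right (hfac p) 1))
    _ ≤ ∏ p ∈ b.primeFactors, p ^ (b.factorization p - 1) * (p + 1) :=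
        Finset.prod_le_prod_of_subset_of_one_le' (Nat.primeFactors_mono h hb)
          fun p _ _ ↦ Nat.one_le_iff_ne_zero.mpr (Nat.mul_ne_zero (pow_ne_zero _
            (Nat.prime_of_mem_primeFactors ‹_›).ne_zero) (Nat.succ_ne_zero p))

/-- `ψ(16 n) ≤ 24 ψ(n)`: with `n = 2^e n₁`, `n₁` odd, `ψ(2^{e+4}) = 3 · 2^{e+3}` is `24 ψ(2^e)` for
`e = 0` and `16 ψ(2^e)` for `e ≥ 1`. [folklore] -/
theorem gamma0Index_sixteen_mul_le {n : ℕ} (hn : n ≠ 0) : gamma0Index (16 * n) ≤ 24 * gamma0Index n := by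
  obtain ⟨e, n₁, hn₁, rfl⟩ := Nat.exists_eq_two_pow_mul_odd hn
  have hcop : ∀ j : ℕ, Nat.Coprime (2 ^ j) n₁ := fun j ↦
    (Nat.coprime_pow_left_iff (n := j + 1) j.succ_pos _ _).mp
      ((Nat.coprime_pow_left_iff j.succ_pos _ _).mpr (Nat.Coprime.pow_left _
        ((Nat.prime_two.coprime_iff_not_dvd).mpr hn₁.not_two_dvd_nat)))
  have h16 : 16 * (2 ^ e * n₁) = 2 ^ (e + 4) * n₁ := by ring
  rw [h16, gamma0Index_mul (hcop (e + 4)), gamma0Index_mul (hcop e),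
    gamma0Index_prime_pow Nat.prime_two (Nat.succ_ne_zero _), ← mul_assoc]
  refine Nat.mul_le_mul_right _ ?_
  rcases Nat.eq_zero_or_pos e with rfl | he
  · simp [gamma0Index]
  · rw [gamma0Index_prime_pow Nat.prime_two he.ne']
    have : 2 ^ (e + 4 - 1) = 16 * 2 ^ (e - 1) := by
      rw [show e + 4 - 1 = (e - 1) + 4 by omega, pow_add]
      ring
    rw [this]
    nlinarith [Nat.one_le_two_pow (n := e - 1)]

end Index

/-! ### Newforms of elliptic curves and of their twists by `−1` -/

section EllipticTwist

open Literature.NumberTheory.EllipticCurves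

variable {N N' : ℕ} [NeZero N] [NeZero N'] {W : WeierstrassCurve ℚ}

/-- For a newform `f ∈ S_k(Γ₀(N))` with `4 ∣ N` every even-indexed coefficient vanishes:
`a₂ = 0` (`p² ∣ N ⇒ a_p = 0`, `IsNewform0.cuspCoeff_eq_zero_of_sq_dvd`) and `a_{2n} = a₂ aₙ` (`U₂`,
Diamond–Shurman Prop. 5.8.5). [cite: DiamondShurman2005, Prop. 5.8.5] -/
theorem IsNewform0.cuspCoeff_eq_zero_of_two_dvd {k : ℤ} {f : CuspForm (Gamma0 N) k}
    (hf : IsNewform0 f) (h4 : 4 ∣ N) {n : ℕ} (hn : 2 ∣ n) : cuspCoeff f n = 0 := by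
  obtain ⟨n', rfl⟩ := hn
  have h2N : 2 ∣ N := (show (2 : ℕ) ∣ 4 by norm_num).trans h4
  rw [hf.cuspCoeff_prime_mul Nat.prime_two n', if_pos h2N, sub_zero,
    hf.cuspCoeff_eq_zero_of_sq_dvd Nat.prime_two (by simpa using h4), zero_mul]

/-- `χ₄(n)² = 1` for odd `n`. [folklore] -/
theorem χ₄_sq_eq_one_of_odd {n : ℕ} (hn : ¬ 2 ∣ n) : (ZMod.χ₄ n : ℤ) ^ 2 = 1 := by
  rw [ZMod.χ₄_nat_eq_if_mod_four, if_neg (by omega)]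
  split_ifs <;> norm_num

variable [W.IsElliptic]

/-- **The coefficients of the newform of `E^{(−1)}` are `χ₄(n)` times those of the newform of `E`**
for odd `n` (`IsNewformOf` pins `aₙ` to the Dirichlet coefficients of the curve, and
`aₙ(E^{(−1)}) = χ₄(n) aₙ(E)`, `LFunction_quadraticTwist_neg_one_apply_of_odd`). [folklore] -/
theorem IsNewformOf.cuspCoeff_quadraticTwist_neg_one_of_odd {f : CuspForm (Gamma0 N) 2}
    {g : CuspForm (Gamma0 N') 2} (hf : IsNewformOf W f) (hg : IsNewformOf (W.quadraticTwist (-1)) g)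
    {n : ℕ} (hn : ¬ 2 ∣ n) : cuspCoeff g n = (ZMod.χ₄ n : ℂ) * cuspCoeff f n := by
  rw [hg.2 n, hf.2 n, W.LFunction_quadraticTwist_neg_one_apply_of_odd hn, Int.cast_mul]

/-- The same identity read as "`g` carries the `χ₄`-twisted packet of `f`" at the odd primes, for the
complex character `χ₄ ⊗ ℂ`. [folklore] -/
theorem IsNewformOf.cuspCoeff_prime_eq_χ₄_mul {f : CuspForm (Gamma0 N) 2}
    {g : CuspForm (Gamma0 N') 2} (hf : IsNewformOf W f) (hg : IsNewformOf (W.quadraticTwist (-1)) g)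
    (p : ℕ) (_hp : p.Prime) (hp2 : ¬ p ∣ 2) :
    cuspCoeff g p = (ZMod.χ₄.ringHomComp (Int.castRingHom ℂ)) p * cuspCoeff f p := by
  have hodd : ¬ 2 ∣ p := by
    intro h
    obtain rfl : 2 = p := (Nat.prime_dvd_prime_iff_eq Nat.prime_two _hp).mp h
    exact hp2 dvd_rfl
  rw [χ₄_ringHomComp_apply_natCast, IsNewformOf.cuspCoeff_quadraticTwist_neg_one_of_odd hf hg hodd]

/-- **Comparison of Petersson norms across a twist by `−1`.**  Let `f ∈ S₂(Γ₀(N))` be the newform of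
an elliptic curve `E/ℚ` with `16 ∣ N`, and `g ∈ S₂(Γ₀(N'))` the newform of its twist `E^{(−1)}`.
Then `ψ(N') · Re (f, f)_{Γ₀(N)} ≤ 4 ψ(N) · Re (g, g)_{Γ₀(N')}`, `ψ = gamma0Index = [SL₂(ℤ) : Γ₀(·)]`.
Proof: `a_{2n}(f) = 0` (`4 ∣ N`) and `aₙ(g) = χ₄(n) aₙ(f)` for odd `n`, so `f = g ⊗ χ₄` coefficientwise,
i.e. `f` (at level `L = N N'`) IS the twist `charTwist L g` by `χ₄ ⊗ ℂ` (`16 ∣ L`); then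
`re_peterssonProduct_charTwist_le` (`m = 4`) and `[Γ₀(·) : Γ₀(L)] ψ(·) = ψ(L)`. [folklore] -/
theorem gamma0Index_mul_re_peterssonProduct_le_of_quadraticTwist_neg_one {f : CuspForm (Gamma0 N) 2}
    {g : CuspForm (Gamma0 N') 2} (hf : IsNewformOf W f) (hg : IsNewformOf (W.quadraticTwist (-1)) g)
    (h16 : 16 ∣ N) :
    (gamma0Index N' : ℝ) * (peterssonProduct (Gamma0 N) 2 f f).re ≤
      4 * gamma0Index N * (peterssonProduct (Gamma0 N') 2 g g).re := by
  set χ : DirichletCharacter ℂ 4 := ZMod.χ₄.ringHomComp (Int.castRingHom ℂ) with hχ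
  have hχq : χ.IsQuadratic := isQuadratic_χ₄_ringHomComp
  have hχp : χ.IsPrimitive := isPrimitive_χ₄_ringHomComp
  -- the common level `L = N N'`
  set L : ℕ := N * N' with hL
  haveI : NeZero L := ⟨mul_ne_zero (NeZero.ne N) (NeZero.ne N')⟩
  have hNL : N ∣ L := dvd_mul_right N N'
  have hN'L : N' ∣ L := dvd_mul_left N' N
  have h16L : 4 ^ 2 ∣ L := (show (4 : ℕ) ^ 2 = 16 by norm_num) ▸ h16.trans hNL
  have h4N : 4 ∣ N := (show (4 : ℕ) ∣ 16 by norm_num).trans h16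
  -- `f` at level `L` is the twist of `g`
  obtain ⟨fL, hfL⟩ := exists_cuspForm_coe_eq_of_le (gamma0_map_le_of_dvd hNL) f
  have htwist : charTwist L hN'L h16L hχq g = fL := by
    refine eq_of_forall_cuspCoeff_eq_gamma0 fun n ↦ ?_
    have hfLn : cuspCoeff fL n = cuspCoeff f n := by simp only [cuspCoeff, hfL]
    rw [cuspCoeff_charTwist L hN'L h16L hχq hχp g n, hfLn, hχ, χ₄_ringHomComp_apply_natCast]
    by_cases hn : 2 ∣ n
    · rw [IsNewform0.cuspCoeff_eq_zero_of_two_dvd hf.1 h4N hn, ZMod.χ₄_nat_eq_if_mod_four,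
        if_pos (Nat.mod_eq_zero_of_dvd hn), Int.cast_zero, zero_mul]
    · rw [IsNewformOf.cuspCoeff_quadraticTwist_neg_one_of_odd hf hg hn, ← mul_assoc, ← Int.cast_mul,
        ← sq, χ₄_sq_eq_one_of_odd hn, Int.cast_one, one_mul]
  -- the comparison at level `L`
  have hcmp := re_peterssonProduct_charTwist_le hN'L h16L (by norm_num : (4 : ℕ) ∣ 24) hχq hχp g
  rw [htwist, peterssonProduct_of_le_eq_card_mul 2 (gamma0_map_le_of_dvd hNL) (Subgroup.map_le_range _ _)
    fL fL f f hfL hfL] at hcmp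
  simp only [Complex.mul_re, Complex.natCast_re, Complex.natCast_im, zero_mul, sub_zero] at hcmp
  -- indices: `[Γ₀(A) : Γ₀(L)] ψ(A) = ψ(L)` for `A = N, N'`
  have hiN := card_quotient_mul_gamma0Index hNL
  have hiN' := card_quotient_mul_gamma0Index hN'L
  set cN : ℕ := Nat.card (((Gamma0 N : Subgroup SL(2, ℤ)) : Subgroup (GL (Fin 2) ℝ)) ⧸
    (((Gamma0 L : Subgroup SL(2, ℤ)) : Subgroup (GL (Fin 2) ℝ))).subgroupOf
      ((Gamma0 N : Subgroup SL(2, ℤ)) : Subgroup (GL (Fin 2) ℝ))) with hcN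
  set cN' : ℕ := Nat.card (((Gamma0 N' : Subgroup SL(2, ℤ)) : Subgroup (GL (Fin 2) ℝ)) ⧸
    (((Gamma0 L : Subgroup SL(2, ℤ)) : Subgroup (GL (Fin 2) ℝ))).subgroupOf
      ((Gamma0 N' : Subgroup SL(2, ℤ)) : Subgroup (GL (Fin 2) ℝ))) with hcN'
  have hψN : (0 : ℝ) < gamma0Index N := Nat.cast_pos.mpr (gamma0Index_pos N)
  have hψN' : (0 : ℝ) < gamma0Index N' := Nat.cast_pos.mpr (gamma0Index_pos N')
  have hψL : (0 : ℝ) < gamma0Index L := Nat.cast_pos.mpr (gamma0Index_pos L)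
  have hPf : 0 ≤ (peterssonProduct (Gamma0 N) 2 f f).re := re_peterssonProduct_self_nonneg_level _ 2 f
  have hPg : 0 ≤ (peterssonProduct (Gamma0 N') 2 g g).re := re_peterssonProduct_self_nonneg_level _ 2 g
  have hiNr : (cN : ℝ) * gamma0Index N = gamma0Index L := by exact_mod_cast hiN
  have hiN'r : (cN' : ℝ) * gamma0Index N' = gamma0Index L := by exact_mod_cast hiN'
  -- `cN · Re(f,f) ≤ 4 cN' · Re(g,g)`; multiply by `ψ(N) ψ(N')` and cancel `ψ(L)`
  have key : (gamma0Index L : ℝ) * ((gamma0Index N' : ℝ) * (peterssonProduct (Gamma0 N) 2 f f).re) ≤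
      (gamma0Index L : ℝ) * (4 * gamma0Index N * (peterssonProduct (Gamma0 N') 2 g g).re) := by
    calc (gamma0Index L : ℝ) * ((gamma0Index N' : ℝ) * (peterssonProduct (Gamma0 N) 2 f f).re)
        = gamma0Index N' * gamma0Index N * ((cN : ℝ) * (peterssonProduct (Gamma0 N) 2 f f).re) := by
          rw [← hiNr]; ring
      _ ≤ gamma0Index N' * gamma0Index N * (4 * cN' * (peterssonProduct (Gamma0 N') 2 g g).re) :=
          mul_le_mul_of_nonneg_left hcmp (by positivity)
      _ = (gamma0Index L : ℝ) * (4 * gamma0Index N * (peterssonProduct (Gamma0 N') 2 g g).re) := by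
          rw [← hiN'r]; ring
  exact le_of_mul_le_mul_left key hψL

/-- **`Re (f, f) ≤ 96 · Re (g, g)` and the levels compare by a factor `16`**: in the situation of
`gamma0Index_mul_re_peterssonProduct_le_of_quadraticTwist_neg_one`, `N ∣ 16 N'` and `N' ∣ 16 N`
(the two newforms carry `χ₄`-twisted packets of each other: Atkin–Lehner–Li,
`level_dvd_mul_sq_of_charTwist_packet`), hence `ψ(N) ≤ ψ(16 N') ≤ 24 ψ(N')`. [folklore] -/
theorem re_peterssonProduct_le_of_quadraticTwist_neg_one {f : CuspForm (Gamma0 N) 2}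
    {g : CuspForm (Gamma0 N') 2} (hf : IsNewformOf W f) (hg : IsNewformOf (W.quadraticTwist (-1)) g)
    (h16 : 16 ∣ N) :
    (peterssonProduct (Gamma0 N) 2 f f).re ≤ 96 * (peterssonProduct (Gamma0 N') 2 g g).re ∧
      N ∣ 16 * N' ∧ N' ∣ 16 * N := by
  set χ : DirichletCharacter ℂ 4 := ZMod.χ₄.ringHomComp (Int.castRingHom ℂ) with hχ
  have hχq : χ.IsQuadratic := isQuadratic_χ₄_ringHomComp
  have hχp : χ.IsPrimitive := isPrimitive_χ₄_ringHomComp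
  -- the packets and the level relations
  have hpk : ∀ p : ℕ, p.Prime → ¬ p ∣ 2 → cuspCoeff g p = χ p * cuspCoeff f p :=
    fun p hp hp2 ↦ IsNewformOf.cuspCoeff_prime_eq_χ₄_mul hf hg p hp hp2
  have hpk' : ∀ p : ℕ, p.Prime → ¬ p ∣ 2 → cuspCoeff f p = χ p * cuspCoeff g p := by
    intro p hp hp2
    have hodd : ¬ 2 ∣ p := by
      intro h
      obtain rfl : 2 = p := (Nat.prime_dvd_prime_iff_eq Nat.prime_two hp).mp h
      exact hp2 dvd_rfl
    have h1 : χ p * χ p = 1 := by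
      rw [hχ, χ₄_ringHomComp_apply_natCast, ← Int.cast_mul, ← sq, χ₄_sq_eq_one_of_odd hodd,
        Int.cast_one]
    rw [hpk p hp hp2, ← mul_assoc, h1, one_mul]
  have hNN' : N ∣ N' * 4 ^ 2 := level_dvd_mul_sq_of_charTwist_packet hχq hχp hf.1 hg.1 hpk two_ne_zero
  have hN'N : N' ∣ N * 4 ^ 2 := level_dvd_mul_sq_of_charTwist_packet hχq hχp hg.1 hf.1 hpk' two_ne_zero
  have h16N' : N' * 4 ^ 2 = 16 * N' := by ring
  have h16N : N * 4 ^ 2 = 16 * N := by ring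
  rw [h16N'] at hNN'
  rw [h16N] at hN'N
  refine ⟨?_, hNN', hN'N⟩
  -- `ψ(N) ≤ ψ(16 N') ≤ 24 ψ(N')`
  have hψ : gamma0Index N ≤ 24 * gamma0Index N' :=
    (gamma0Index_le_of_dvd hNN' (mul_ne_zero (by norm_num) (NeZero.ne N'))).trans
      (gamma0Index_sixteen_mul_le (NeZero.ne N'))
  have hψr : (gamma0Index N : ℝ) ≤ 24 * gamma0Index N' := by exact_mod_cast hψ
  have hA := gamma0Index_mul_re_peterssonProduct_le_of_quadraticTwist_neg_one hf hg h16
  have hψN' : (0 : ℝ) < gamma0Index N' := Nat.cast_pos.mpr (gamma0Index_pos N')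
  have hPg : 0 ≤ (peterssonProduct (Gamma0 N') 2 g g).re := re_peterssonProduct_self_nonneg_level _ 2 g
  have key : (gamma0Index N' : ℝ) * (peterssonProduct (Gamma0 N) 2 f f).re ≤
      gamma0Index N' * (96 * (peterssonProduct (Gamma0 N') 2 g g).re) :=
    calc (gamma0Index N' : ℝ) * (peterssonProduct (Gamma0 N) 2 f f).re
        ≤ 4 * gamma0Index N * (peterssonProduct (Gamma0 N') 2 g g).re := hA
      _ ≤ 4 * (24 * gamma0Index N') * (peterssonProduct (Gamma0 N') 2 g g).re := by gcongr
      _ = gamma0Index N' * (96 * (peterssonProduct (Gamma0 N') 2 g g).re) := by ring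
  exact le_of_mul_le_mul_left key hψN'

/-- **Mai–Murty's exponent `3` for a curve whose twist by `−1` is semistable.**  There is an absolute
`C > 0` such that for every level `N` with `16 ∣ N`, every elliptic curve `E/ℚ` with newform
`f ∈ S₂(Γ₀(N))` (`IsNewformOf E f`) whose twist `E^{(−1)}` has a newform `g` of SQUAREFREE level `N'`
(`IsNewformOf E^{(−1)} g`; e.g. `E^{(−1)}` semistable, `N'` its conductor), one has
`Re (f, f)_{Γ₀(N)} ≤ C · N · (1 + log N)³`: by `re_peterssonProduct_le_of_quadraticTwist_neg_one`,
`Re (f,f) ≤ 96 Re (g,g)` and `N' ≤ 16 N`, and `Re (g,g) ≤ C₀ N'(1 + log N')³` is the tree's squarefree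
case `exists_petersson_le_mul_log_cube_of_squarefree` (Mai–Murty 1994, §2, by Rademacher's
Phragmén–Lindelöf); `1 + log (16N) ≤ 4(1 + log N)`, so `C = 96 · 16 · 64 · C₀`. This covers the
Frey–Hellegouarch curves `y² = x(x−a)(x+b)` with `2⁴ ∥ N` whose sign-swapped model
`y² = x(x+a)(x−b) = E^{(−1)}` is semistable. [cite: MaiMurty1994, §2, Proposition] -/
theorem exists_petersson_le_mul_log_cube_of_quadraticTwist_neg_one_squarefree :
    ∃ C : ℝ, 0 < C ∧ ∀ (N N' : ℕ) [NeZero N] [NeZero N'], 16 ∣ N → Squarefree N' →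
      ∀ (W : WeierstrassCurve ℚ) [W.IsElliptic] (f : CuspForm (Gamma0 N) 2)
        (g : CuspForm (Gamma0 N') 2), IsNewformOf W f → IsNewformOf (W.quadraticTwist (-1)) g →
        (peterssonProduct (Gamma0 N) 2 f f).re ≤ C * N * (1 + Real.log N) ^ 3 := by
  obtain ⟨C₀, hC₀, hsq⟩ := exists_petersson_le_mul_log_cube_of_squarefree
  refine ⟨96 * 16 * 64 * C₀, by positivity, ?_⟩
  intro N N' _ _ h16 hsf W _ f g hf hg
  haveI : (W.quadraticTwist (-1 : ℚ)).IsElliptic := W.isElliptic_quadraticTwist (by norm_num)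
  obtain ⟨hcmp, -, hN'N⟩ := re_peterssonProduct_le_of_quadraticTwist_neg_one hf hg h16
  have hg' := hsq N' hsf (W.quadraticTwist (-1)) g hg
  have hN1 : (1 : ℝ) ≤ N := by exact_mod_cast NeZero.one_le (n := N)
  have hN'le : (N' : ℝ) ≤ 16 * N := by
    exact_mod_cast Nat.le_of_dvd (Nat.mul_pos (by norm_num) (NeZero.pos N)) hN'N
  have hlogN : 0 ≤ Real.log N := Real.log_nonneg hN1
  have hN'1 : (1 : ℝ) ≤ N' := by exact_mod_cast NeZero.one_le (n := N')
  have hlog : 1 + Real.log N' ≤ 4 * (1 + Real.log N) := by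
    have h1 : Real.log N' ≤ Real.log (16 * N) := Real.log_le_log (by positivity) hN'le
    have h2 : Real.log (16 * N) = Real.log 16 + Real.log N :=
      Real.log_mul (by norm_num) (by positivity)
    have h3 : Real.log 16 ≤ 3 := by
      rw [show (16 : ℝ) = 2 ^ 4 by norm_num, Real.log_pow]
      have := Real.log_two_lt_d9
      norm_num at this ⊢
      linarith
    linarith
  have hlog0 : 0 ≤ 1 + Real.log N' := by linarith [Real.log_nonneg hN'1]
  calc (peterssonProduct (Gamma0 N) 2 f f).re ≤ 96 * (peterssonProduct (Gamma0 N') 2 g g).re := hcmp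
    _ ≤ 96 * (C₀ * N' * (1 + Real.log N') ^ 3) := by gcongr
    _ ≤ 96 * (C₀ * (16 * N) * (4 * (1 + Real.log N)) ^ 3) := by gcongr
    _ = 96 * 16 * 64 * C₀ * N * (1 + Real.log N) ^ 3 := by ring

/-- `N (1 + log N)³ ≤ 4³ N^{1+ε}/ε³` for `N ≥ 1`, `0 < ε ≤ 1` (from `1 + ε t/3 ≤ e^{ε t/3} = N^{ε/3}`,
`t = log N`). [folklore] -/
theorem mul_one_add_log_pow_three_le_rpow {x : ℝ} (hx : 1 ≤ x) {ε : ℝ} (hε : 0 < ε) (hε1 : ε ≤ 1) :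
    x * (1 + Real.log x) ^ 3 ≤ 4 ^ 3 * x ^ (1 + ε) / ε ^ 3 := by
  have hx0 : 0 < x := by linarith
  set t : ℝ := Real.log x with ht
  have ht0 : 0 ≤ t := Real.log_nonneg hx
  set M : ℝ := x ^ (ε / 3) with hM
  have hexp : Real.exp (ε * t / 3) = M := by
    rw [hM, Real.rpow_def_of_pos hx0, ht]; congr 1; ring
  have hM1 : 1 ≤ M := Real.one_le_rpow hx (by positivity)
  have h1 : ε * t / 3 + 1 ≤ M := hexp ▸ Real.add_one_le_exp (ε * t / 3)
  have hkey : 1 + t ≤ 4 / ε * M := by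
    rw [div_mul_eq_mul_div, le_div_iff₀ hε]
    nlinarith [mul_nonneg hε.le ht0]
  have hkey3 : (1 + t) ^ 3 ≤ (4 / ε * M) ^ 3 := pow_le_pow_left₀ (by linarith) hkey 3
  have hM3 : M ^ 3 = x ^ ε := by
    rw [hM, ← Real.rpow_natCast, ← Real.rpow_mul hx0.le]
    congr 1; push_cast; ring
  have hxε : x * x ^ ε = x ^ (1 + ε) := by rw [Real.rpow_add hx0, Real.rpow_one]
  calc x * (1 + t) ^ 3 ≤ x * (4 / ε * M) ^ 3 := by gcongr
    _ = 4 ^ 3 * (x * M ^ 3) / ε ^ 3 := by field_simp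
    _ = 4 ^ 3 * x ^ (1 + ε) / ε ^ 3 := by rw [hM3, hxε]

/-- **Power form `(f, f) ≪ N^{1+ε}/ε³`** of
`exists_petersson_le_mul_log_cube_of_quadraticTwist_neg_one_squarefree` (the shape in which the `abc`
routes consume the Petersson upper bound): an absolute `C > 0` with
`Re (f, f) ≤ C · N^{1+ε}/ε³` for all `0 < ε ≤ 1`, all `N` with `16 ∣ N`, `E/ℚ`, `f`, `g` as there.
[cite: MaiMurty1994, §2, Proposition] -/
theorem exists_petersson_le_mul_rpow_of_quadraticTwist_neg_one_squarefree :
    ∃ C : ℝ, 0 < C ∧ ∀ ε : ℝ, 0 < ε → ε ≤ 1 → ∀ (N N' : ℕ) [NeZero N] [NeZero N'], 16 ∣ N → Squarefree N' →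
      ∀ (W : WeierstrassCurve ℚ) [W.IsElliptic] (f : CuspForm (Gamma0 N) 2)
        (g : CuspForm (Gamma0 N') 2), IsNewformOf W f → IsNewformOf (W.quadraticTwist (-1)) g →
        (peterssonProduct (Gamma0 N) 2 f f).re ≤ C * (N : ℝ) ^ (1 + ε) / ε ^ 3 := by
  obtain ⟨C, hC, h⟩ := exists_petersson_le_mul_log_cube_of_quadraticTwist_neg_one_squarefree
  refine ⟨C * 4 ^ 3, by positivity, fun ε hε hε1 N N' _ _ h16 hsf W _ f g hf hg ↦ ?_⟩
  have hN1 : (1 : ℝ) ≤ N := by exact_mod_cast NeZero.one_le (n := N)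
  calc (peterssonProduct (Gamma0 N) 2 f f).re ≤ C * N * (1 + Real.log N) ^ 3 :=
        h N N' h16 hsf W f g hf hg
    _ = C * (N * (1 + Real.log N) ^ 3) := by ring
    _ ≤ C * (4 ^ 3 * (N : ℝ) ^ (1 + ε) / ε ^ 3) :=
        mul_le_mul_of_nonneg_left (mul_one_add_log_pow_three_le_rpow hN1 hε hε1) hC.le
    _ = C * 4 ^ 3 * (N : ℝ) ^ (1 + ε) / ε ^ 3 := by ring

end EllipticTwist

end Literature.NumberTheory.Automorphic

end
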